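import Summits.NavierStokesRegularity.NavierStokesRegularity.Theses.PalasekTowerBreakdown
import Summits.NavierStokesRegularity.FluidComputer.PalasekTowerGermHostExplicit
import Summits.NavierStokesRegularity.FluidComputer.PalasekTowerHeredityWitnessWindow

/-!
# `EpisodeBase` BY NAME from ONE WINDOW RUN of an explicit germ design `S*(U, ρ, σ₀, ε, c₄)`

Cell `ns-blowup`, seat `ns-blowup-ecbridge-3` (g3); GROUP C «BRIDGE SUPPORT» of the route
`PalasekTowerBreakdown`, crux `EpisodeBase` (item stmt-NavierStokesRegularity-19179, R2 of record).
LABEL: E–C typing (KERNEL, proofs only, by name). WHAT THIS IS NOT: not Navier–Stokes evidence — a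
conditional whose hypothesis is ONE classical forced Navier–Stokes flow on the first growth window
with the level-`1` readouts; nothing is asserted about whether such a flow exists. HELPER for 19179
(`--supports … --as helper`), closes nothing.

## The certificate shape of the crux for a named germ design

Combining the explicit germ host (`Germ.LineGermData.hostPreparationD_exact`, p445479: every host of
the explicit germ schedule `d.schedule` is registered at level `0`) with the WINDOW FORM of heredity
(seat ecbridge-6, `Stage.exists_extends_of_window_solution`, p433879: a registered stage plus ONE
classical finite-energy solution on `[τ₀ − δ, τ₁]` restarting from the stage's own state, below the
ceiling on the window and with the next floors at `τ₁`, IS a stage one level up — forced Serrin–Masuda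
on the overlap, no W14), the route's crux BY NAME follows from data in which EVERYTHING IS EXPLICIT:

`palasekTowerBreakdown_episodeBase_of_lineGerm_window`: `LineGermData U ρ σ₀ ε c₄` (readouts of `U`,
line anchor at `σ₀`, residual bound on `[1, 1 + ε]`) and a classical solution `(v, q)` on
`[1 − δ, 1 + w₀]` (`0 < δ ≤ 1/2`) of Navier–Stokes at unit viscosity forced by
`lineForce U σ₀ ε = fade • (NS residual of the line germ)` (`= 0` from `1 + ε` on), RESTARTING FROM THE
CLOSED-FORM STATE `v(1 − δ) = U + σline σ₀ (1 − δ) • V` (`V = P(ΔU − (U·∇)U)`,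
`σline σ₀ t = σ₀(exp((t−1)/σ₀) − 1)`), with finite energy, `‖v‖ ≤ (5/3)Y₁` on `[1, 1 + w₀] × ℝ³`,
and at `t = 1 + w₀`, in `B̄(0, ρ)`: speed `≥ Y₁`, gradient `≥ A₁`, an `N₁`-core loop with circulation
`≥ N₁^{β−2}` ⟹ `EpisodeBase`. This is the statement a certified window run targets.

References: S. Palasek, arXiv:2605.13827 §4 (Step 2, the first episode) [cite: Palasek2026ElementaryModel, §4];
H. Sohr, *The Navier–Stokes Equations* (2001), Ch. V Thm. 1.5.1 [cite: Sohr2001, Ch. V Thm. 1.5.1].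
-/

noncomputable section

-- `Summit.<Summit>.<Problem>` is the tree's mandated summit-side namespace (CONVENTIONS §2); for this
-- single-conjunct summit the two coincide, so the duplicate is deliberate.
set_option linter.dupNamespace false

namespace Summit.NavierStokesRegularity.NavierStokesRegularity.Theorems

open Set Function MeasureTheory
open scoped ENNReal
open Summit.NavierStokesRegularity.FluidComputer.PalasekTowerClayBridge
open Summit.NavierStokesRegularity.FluidComputer.PalasekTowerClayBridge.Germ
open Literature.Analysis.FluidPDE

variable {U : EuclideanSpace ℝ (Fin 3) → EuclideanSpace ℝ (Fin 3)} {ρ σ₀ ε c₄ : ℝ}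

/-- **Every registered level-`0` stage of the explicit germ schedule IS the line germ on `[0, 1]`**
(any margin; the stage pins the design's classical finite-energy flow — `Stage.velocity_eq_of_classical`,
forced Serrin–Masuda, no W14). [cite: Sohr2001, Ch. V Thm. 1.5.1] -/
theorem palasekTowerBreakdown_lineGerm_stage_u_eq (d : LineGermData U ρ σ₀ ε c₄)
    {m : Margins TowerRates.wide} (s₀ : Stage 1 TowerRates.wide d.schedule m 0) :
    ∀ t ∈ Icc (0 : ℝ) 1, s₀.u t = lineVel U σ₀ t := by
  have hτ0 : d.schedule.τ 0 = 1 := d.schedule_τ_zero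
  have h0 : lineVel U σ₀ 0 = d.schedule.u₀ := by rw [lineVel_zero]; rfl
  have key := s₀.velocity_eq_of_classical one_pos (T' := 1) (by rw [hτ0]) d.isClassicalNSSolutionOn_vel
    h0 d.energy_vel
  intro t ht
  rw [hτ0] at key
  exact (key t ht).symm

/-- **`EpisodeBase` FROM ONE WINDOW RUN OF AN EXPLICIT GERM DESIGN.** Let `(U, ρ, σ₀, ε, c₄)` fill the
explicit slot `LineGermData`, and let `(v, q)` be a classical solution on `[1 − δ, 1 + w₀]`
(`0 < δ ≤ 1/2`, `w₀ = Host.wfirst`, `1 + w₀ = Host.τfirst`) of Navier–Stokes at unit viscosity with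
force `lineForce U σ₀ ε`, restarting from the closed-form state `v (1 − δ) = U + σline σ₀ (1 − δ) • V`,
with finite energy, bounded by `(5/3) Y₁` on `[1, 1 + w₀] × ℝ³`, and showing at `t = 1 + w₀`, in
`B̄(0, ρ)`, the level-`1` speed floor `Y₁`, strain floor `A₁` and an `N₁`-core loop with circulation
`≥ N₁^{β−2}`. Then the route's crux `EpisodeBase` holds (the germ host is the level-`0` stage; the
window run extends it to level `1`, `Stage.exists_extends_of_window_solution`).
[cite: Palasek2026ElementaryModel, §4] -/
theorem palasekTowerBreakdown_episodeBase_of_lineGerm_window (d : LineGermData U ρ σ₀ ε c₄)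
    {δ : ℝ} (hδ : 0 < δ) (hδ' : δ ≤ 1 / 2)
    {v : ℝ → EuclideanSpace ℝ (Fin 3) → EuclideanSpace ℝ (Fin 3)}
    {q : ℝ → EuclideanSpace ℝ (Fin 3) → ℝ}
    (hcl : IsClassicalNSSolutionOn (Icc (1 - δ) Host.τfirst) 1 (lineForce U σ₀ ε) v q)
    (h0 : v (1 - δ) = fun x => U x + σline σ₀ (1 - δ) • accel 1 U x)
    (henergy : ∃ C : ℝ≥0∞, C < ⊤ ∧ ∀ t ∈ Icc (1 - δ) Host.τfirst, ∫⁻ x, ‖v t x‖ₑ ^ 2 ≤ C)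
    (hceil : ∀ t ∈ Icc (1 : ℝ) Host.τfirst, ∀ x, ‖v t x‖ ≤ 5 / 3 * TowerRates.wide.Y 1)
    (hfloor : ∃ x, ‖x‖ ≤ ρ ∧ TowerRates.wide.Y 1 ≤ ‖v Host.τfirst x‖)
    (hstrain : ∃ x, ‖x‖ ≤ ρ ∧ TowerRates.wide.A 1 ≤ ‖fderiv ℝ (v Host.τfirst) x‖)
    (hcore : ∃ (x : EuclideanSpace ℝ (Fin 3)) (γ : ℝ → EuclideanSpace ℝ (Fin 3)),
      ‖x‖ ≤ ρ ∧ ContDiff ℝ 1 γ ∧ γ 0 = γ 1 ∧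
      (∀ s ∈ Icc (0 : ℝ) 1, γ s ∈ Metric.closedBall x (1 / TowerRates.wide.N 1)) ∧
      (∀ s ∈ Icc (0 : ℝ) 1, ‖deriv γ s‖ ≤ 8 * Real.pi / TowerRates.wide.N 1) ∧
      TowerRates.wide.N 1 ^ (TowerRates.wide.β - 2) ≤ circulation (v Host.τfirst) γ) :
    Summit.NavierStokesRegularity.NavierStokesRegularity.Theses.PalasekTowerBreakdown.EpisodeBase := by
  obtain ⟨s₀⟩ := d.stage
  have hτ0 : d.schedule.τ 0 = 1 := d.schedule_τ_zero
  have hτ1 : d.schedule.τ 1 = Host.τfirst := d.schedule_τ_one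
  -- the restart state is the stage's own state at `1 - δ`
  have hrestart : v (d.schedule.τ 0 - δ) = s₀.u (d.schedule.τ 0 - δ) := by
    rw [hτ0, h0, palasekTowerBreakdown_lineGerm_stage_u_eq d s₀ (1 - δ) ⟨by linarith, by linarith⟩]
    funext x
    exact (lineVel_of_half_le U σ₀ (by linarith) x).symm
  have hcl' : IsClassicalNSSolutionOn (Icc (d.schedule.τ 0 - δ) (d.schedule.τ (0 + 1))) 1
      d.schedule.f v q := by
    rw [hτ0, zero_add, hτ1]; exact hcl
  have henergy' : ∃ C : ℝ≥0∞, C < ⊤ ∧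
      ∀ t ∈ Icc (d.schedule.τ 0 - δ) (d.schedule.τ (0 + 1)), ∫⁻ x, ‖v t x‖ₑ ^ 2 ≤ C := by
    rw [hτ0, zero_add, hτ1]; exact henergy
  have hceil' : ∀ t ∈ Icc (d.schedule.τ 0) (d.schedule.τ (0 + 1)), ∀ x,
      ‖v t x‖ ≤ d.schedule.c₂ * TowerRates.wide.Y (0 + 1) := by
    rw [hτ0, zero_add, hτ1, d.schedule_c₂]; exact hceil
  have hfloor' : ∃ x, ‖x‖ ≤ d.schedule.radius ∧
      d.schedule.c₁ * TowerRates.wide.Y (0 + 1) ≤ ‖v (d.schedule.τ (0 + 1)) x‖ := by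
    rw [zero_add, hτ1, d.schedule_radius, d.schedule_c₁, one_mul]; exact hfloor
  have hstrain' : ∃ x, ‖x‖ ≤ d.schedule.radius ∧
      d.schedule.c₁ * TowerRates.wide.A (0 + 1) ≤ ‖fderiv ℝ (v (d.schedule.τ (0 + 1))) x‖ := by
    rw [zero_add, hτ1, d.schedule_radius, d.schedule_c₁, one_mul]; exact hstrain
  have hcore' : ∃ (x : EuclideanSpace ℝ (Fin 3)) (γ : ℝ → EuclideanSpace ℝ (Fin 3)),
      ‖x‖ ≤ d.schedule.radius ∧ ContDiff ℝ 1 γ ∧ γ 0 = γ 1 ∧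
      (∀ s ∈ Icc (0 : ℝ) 1, γ s ∈ Metric.closedBall x (1 / TowerRates.wide.N (0 + 1))) ∧
      (∀ s ∈ Icc (0 : ℝ) 1, ‖deriv γ s‖ ≤ 8 * Real.pi / TowerRates.wide.N (0 + 1)) ∧
      d.schedule.c₁ * TowerRates.wide.N (0 + 1) ^ (TowerRates.wide.β - 2) ≤
        circulation (v (d.schedule.τ (0 + 1))) γ := by
    rw [zero_add, hτ1, d.schedule_radius, d.schedule_c₁, one_mul]; exact hcore
  have hδ1 : δ ≤ d.schedule.τ 0 := by rw [hτ0]; linarith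
  obtain ⟨s₁, -⟩ := s₀.exists_extends_of_window_solution one_pos hδ hδ1 hcl' hrestart henergy' hceil'
    hfloor' hstrain' hcore'
  exact ⟨d.schedule, d.schedule_pins, d.schedule_rigid, d.schedule_quiet, ⟨s₁⟩⟩

/-- **`EpisodeBase` from ONE LEVEL WITNESS of the explicit germ schedule** (no re-push; the explicit
twin of `palasekTowerBreakdown_episodeBase_of_germ_levelWitness`). [cite: Sohr2001, Ch. V Thm. 1.5.1] -/
theorem palasekTowerBreakdown_episodeBase_of_lineGerm_levelWitness (d : LineGermData U ρ σ₀ ε c₄)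
    (hW : d.schedule.LevelWitness 1 0) :
    Summit.NavierStokesRegularity.NavierStokesRegularity.Theses.PalasekTowerBreakdown.EpisodeBase :=
  d.episodeBaseG_of_firstEpisodeD
    (firstEpisodeD_exact_of_levelWitness_self d.schedule_pins d.schedule_rigid d.schedule_quiet hW)

/-- **`EpisodeBase` FROM ONE RUN FROM REST OF AN EXPLICIT GERM DESIGN** — the level witness written
out with every field of the schedule unfolded: a classical solution `(v, q)` on `[0, 1 + w₀]` of
Navier–Stokes at unit viscosity with force `lineForce U σ₀ ε` (= the NS residual of the line germ on
`[0, 1]`, faded on `[1, 1 + ε]`, zero after) from the ZERO datum, with finite energy, bounded by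
`(5/3) Y₁` on `[1, 1 + w₀] × ℝ³`, showing at `t = 1 + w₀` in `B̄(0, ρ)` the level-`1` speed floor `Y₁`,
strain floor `A₁` and an `N₁`-core loop with circulation `≥ N₁^{β−2}`. On `[0, 1]` such a `v` IS the line
germ (`palasekTowerBreakdown_lineGerm_stage_u_eq` / forced Serrin–Masuda), so this is the same
certificate as the window form, integrated from rest instead of restarted. [cite: Palasek2026ElementaryModel, §4] -/
theorem palasekTowerBreakdown_episodeBase_of_lineGerm_run (d : LineGermData U ρ σ₀ ε c₄)
    {v : ℝ → EuclideanSpace ℝ (Fin 3) → EuclideanSpace ℝ (Fin 3)}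
    {q : ℝ → EuclideanSpace ℝ (Fin 3) → ℝ}
    (hcl : IsClassicalNSSolutionOn (Icc 0 Host.τfirst) 1 (lineForce U σ₀ ε) v q)
    (h0 : v 0 = 0)
    (henergy : ∃ C : ℝ≥0∞, C < ⊤ ∧ ∀ t ∈ Icc (0 : ℝ) Host.τfirst, ∫⁻ x, ‖v t x‖ₑ ^ 2 ≤ C)
    (hceil : ∀ t ∈ Icc (1 : ℝ) Host.τfirst, ∀ x, ‖v t x‖ ≤ 5 / 3 * TowerRates.wide.Y 1)
    (hfloor : ∃ x, ‖x‖ ≤ ρ ∧ TowerRates.wide.Y 1 ≤ ‖v Host.τfirst x‖)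
    (hstrain : ∃ x, ‖x‖ ≤ ρ ∧ TowerRates.wide.A 1 ≤ ‖fderiv ℝ (v Host.τfirst) x‖)
    (hcore : ∃ (x : EuclideanSpace ℝ (Fin 3)) (γ : ℝ → EuclideanSpace ℝ (Fin 3)),
      ‖x‖ ≤ ρ ∧ ContDiff ℝ 1 γ ∧ γ 0 = γ 1 ∧
      (∀ s ∈ Icc (0 : ℝ) 1, γ s ∈ Metric.closedBall x (1 / TowerRates.wide.N 1)) ∧
      (∀ s ∈ Icc (0 : ℝ) 1, ‖deriv γ s‖ ≤ 8 * Real.pi / TowerRates.wide.N 1) ∧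
      TowerRates.wide.N 1 ^ (TowerRates.wide.β - 2) ≤ circulation (v Host.τfirst) γ) :
    Summit.NavierStokesRegularity.NavierStokesRegularity.Theses.PalasekTowerBreakdown.EpisodeBase := by
  refine palasekTowerBreakdown_episodeBase_of_lineGerm_levelWitness d ⟨v, q, ?_, ?_, ?_, ?_, ?_, ?_, ?_⟩
  · show IsClassicalNSSolutionOn (Icc 0 (d.schedule.τ (0 + 1))) 1 d.schedule.f v q
    rw [zero_add, d.schedule_τ_one]; exact hcl
  · exact h0
  · show ∃ C : ℝ≥0∞, C < ⊤ ∧ ∀ t ∈ Icc 0 (d.schedule.τ (0 + 1)), ∫⁻ x, ‖v t x‖ₑ ^ 2 ≤ C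
    rw [zero_add, d.schedule_τ_one]; exact henergy
  · show ∀ t ∈ Icc (d.schedule.τ 0) (d.schedule.τ (0 + 1)), ∀ x,
      ‖v t x‖ ≤ d.schedule.c₂ * TowerRates.wide.Y (0 + 1)
    rw [d.schedule_τ_zero, zero_add, d.schedule_τ_one, d.schedule_c₂]; exact hceil
  · show ∃ x, ‖x‖ ≤ d.schedule.radius ∧
      d.schedule.c₁ * TowerRates.wide.Y (0 + 1) ≤ ‖v (d.schedule.τ (0 + 1)) x‖
    rw [zero_add, d.schedule_τ_one, d.schedule_radius, d.schedule_c₁, one_mul]; exact hfloor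
  · show ∃ x, ‖x‖ ≤ d.schedule.radius ∧
      d.schedule.c₁ * TowerRates.wide.A (0 + 1) ≤ ‖fderiv ℝ (v (d.schedule.τ (0 + 1))) x‖
    rw [zero_add, d.schedule_τ_one, d.schedule_radius, d.schedule_c₁, one_mul]; exact hstrain
  · show ∃ (x : EuclideanSpace ℝ (Fin 3)) (γ : ℝ → EuclideanSpace ℝ (Fin 3)),
      ‖x‖ ≤ d.schedule.radius ∧ ContDiff ℝ 1 γ ∧ γ 0 = γ 1 ∧
      (∀ s ∈ Icc (0 : ℝ) 1, γ s ∈ Metric.closedBall x (1 / TowerRates.wide.N (0 + 1))) ∧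
      (∀ s ∈ Icc (0 : ℝ) 1, ‖deriv γ s‖ ≤ 8 * Real.pi / TowerRates.wide.N (0 + 1)) ∧
      d.schedule.c₁ * TowerRates.wide.N (0 + 1) ^ (TowerRates.wide.β - 2) ≤
        circulation (v (d.schedule.τ (0 + 1))) γ
    rw [zero_add, d.schedule_τ_one, d.schedule_radius, d.schedule_c₁, one_mul]; exact hcore

end Summit.NavierStokesRegularity.NavierStokesRegularity.Theorems

end
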